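import Mathlib
import Summits.Ventures.PercRepro2.HCov
import Summits.Ventures.PercRepro2.PocketTransport
import Summits.Ventures.PercRepro2.RootLeafUPocketGraph
import Summits.Ventures.PercRepro2.RootLeafUPocketShare
import Summits.Ventures.PercRepro2.RootLeafUPocketFacts
import Summits.Ventures.PercRepro2.RootLeafUPocketAddEdge
import Summits.Ventures.PercRepro2.RootLeafUPocketAddEdge2

/-!
# Adding one edge outside a pocket, III: a second new edge, and the two-edge outside `c – u – a₂`
(blind cell PercRepro2, p4 g22; S3 (G4-u), the «limit» route of proofs/P4-G19-OUTSIDE.md §2 for `(P-03)`; no definitions)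

`prob_option_fiber` disintegrates the product measure on `Option E` along the new edge; `prob_inn_option_gen` is the
pocket transfer for a new edge `x–y` on top of ANY inner weights (no zeroing); the two-edge configuration
`none ↦ b` (edge `u–c`), `some none ↦ b'` (edge `u–a₂`), all else closed, has the pattern `(b', b, b ∧ b')` on
`(u, a₂, c)` (`two_edge_pattern`), `PD` iff both edges closed (`two_edge_PD`) and never `T` (`two_edge_T`).
-/

namespace Summit.Ventures.PercRepro2

open UnionCluster CovForm

namespace RootLeafU

namespace PocketAddEdge

variable {V : Type*} {E : Type*}

section Fiber

variable [Fintype E] [DecidableEq E] {R : Type*} [CommRing R]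

/-- Disintegration along the new edge: `P(A') = P(none open)·P(ω ↦ (true, ω) ∈ A') + P(none closed)·P(ω ↦ (false, ω) ∈ A')`. -/
theorem prob_option_fiber (p' : Option E → R) (A' : Set (Config (Option E))) :
    prob p' A' = edgeFactor (p' none) true * prob (fun e => p' (some e)) {ω : Config E | (Equiv.piOptionEquivProd (β := fun _ : Option E => Bool)).symm (true, ω) ∈ A'} +
      edgeFactor (p' none) false * prob (fun e => p' (some e)) {ω : Config E | (Equiv.piOptionEquivProd (β := fun _ : Option E => Bool)).symm (false, ω) ∈ A'} := by
  classical
  unfold prob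
  rw [← (Equiv.piOptionEquivProd (β := fun _ : Option E => Bool)).symm.sum_comp, Fintype.sum_prod_type,
    Fintype.sum_bool, Finset.mul_sum, Finset.mul_sum]
  congr 1 <;> refine Finset.sum_congr rfl fun ω _ => ?_
  · by_cases h : (Equiv.piOptionEquivProd (β := fun _ : Option E => Bool)).symm (true, ω) ∈ A'
    · rw [Set.indicator_of_mem h, Set.indicator_of_mem (show ω ∈ {ω : Config E | (Equiv.piOptionEquivProd (β := fun _ : Option E => Bool)).symm (true, ω) ∈ A'} from h), weight_option_symm]
    · rw [Set.indicator_of_notMem h, Set.indicator_of_notMem (show ω ∉ {ω : Config E | (Equiv.piOptionEquivProd (β := fun _ : Option E => Bool)).symm (true, ω) ∈ A'} from h), mul_zero]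
  · by_cases h : (Equiv.piOptionEquivProd (β := fun _ : Option E => Bool)).symm (false, ω) ∈ A'
    · rw [Set.indicator_of_mem h, Set.indicator_of_mem (show ω ∈ {ω : Config E | (Equiv.piOptionEquivProd (β := fun _ : Option E => Bool)).symm (false, ω) ∈ A'} from h), weight_option_symm]
    · rw [Set.indicator_of_notMem h, Set.indicator_of_notMem (show ω ∉ {ω : Config E | (Equiv.piOptionEquivProd (β := fun _ : Option E => Bool)).symm (false, ω) ∈ A'} from h), mul_zero]

end Fiber

section TransferGen

variable [Fintype E] [DecidableEq E] [Fintype V] [DecidableEq V] {R : Type*} [CommRing R]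
variable {ends : E → Sym2 V} {P : Set V} {x y u a₂ c b : V} {inn : Config E → Config E}

/-- **Pocket transfer** for a new edge `x–y` on top of arbitrary weights `p₁` (no zeroing). -/
theorem prob_inn_option_gen (p₁ : E → R) (r : R) (hx : x ∉ P) (hy : y ∉ P)
    (hinn : (∀ ω e, e ∈ touches ends P → inn ω e = ω e) ∧ (∀ ω e, e ∉ touches ends P → inn ω e = false))
    (inn' : Config (Option E) → Config (Option E))
    (hinn' : (∀ ω e, e ∈ touches (fun o : Option E => o.elim s(x, y) ends) P → inn' ω e = ω e) ∧
      (∀ ω e, e ∉ touches (fun o : Option E => o.elim s(x, y) ends) P → inn' ω e = false))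
    (v : Bool × Bool × Bool × Bool × Bool × Bool) :
    prob (fun o : Option E => o.elim r p₁) {ω' : Config (Option E) | inn' ω' ∈ {ω'' : Config (Option E) | (decide (Conn (fun o : Option E => o.elim s(x, y) ends) ω'' u a₂), decide (Conn (fun o : Option E => o.elim s(x, y) ends) ω'' u c), decide (Conn (fun o : Option E => o.elim s(x, y) ends) ω'' u b), decide (Conn (fun o : Option E => o.elim s(x, y) ends) ω'' a₂ c), decide (Conn (fun o : Option E => o.elim s(x, y) ends) ω'' a₂ b), decide (Conn (fun o : Option E => o.elim s(x, y) ends) ω'' c b)) = v}} =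
    prob p₁ {ω : Config E | inn ω ∈ {ω'' : Config E | (decide (Conn ends ω'' u a₂), decide (Conn ends ω'' u c), decide (Conn ends ω'' u b), decide (Conn ends ω'' a₂ c), decide (Conn ends ω'' a₂ b), decide (Conn ends ω'' c b)) = v}} := by
  classical
  have h0 : ∀ ω' : Config (Option E), inn' ω' none = false := fun ω' =>
    hinn'.2 ω' none (by rw [touches_option_xy hx hy]; rintro ⟨e, he, _⟩; cases he)
  have hsome : ∀ ω' : Config (Option E), (fun e => inn' ω' (some e)) = inn (fun e => ω' (some e)) := by
    intro ω'
    funext e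
    by_cases he : e ∈ touches ends P
    · rw [hinn'.1 ω' (some e) ((touches_option_xy hx hy (some e)).2 ⟨e, rfl, he⟩), hinn.1 _ e he]
    · rw [hinn'.2 ω' (some e) (fun h => he (by obtain ⟨e', he', h'⟩ := (touches_option_xy hx hy (some e)).1 h; cases he'; exact h')), hinn.2 _ e he]
  have hset : {ω' : Config (Option E) | inn' ω' ∈ {ω'' : Config (Option E) | (decide (Conn (fun o : Option E => o.elim s(x, y) ends) ω'' u a₂), decide (Conn (fun o : Option E => o.elim s(x, y) ends) ω'' u c), decide (Conn (fun o : Option E => o.elim s(x, y) ends) ω'' u b), decide (Conn (fun o : Option E => o.elim s(x, y) ends) ω'' a₂ c), decide (Conn (fun o : Option E => o.elim s(x, y) ends) ω'' a₂ b), decide (Conn (fun o : Option E => o.elim s(x, y) ends) ω'' c b)) = v}} =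
      {ω' : Config (Option E) | (fun e => ω' (some e)) ∈ {ω : Config E | inn ω ∈ {ω'' : Config E | (decide (Conn ends ω'' u a₂), decide (Conn ends ω'' u c), decide (Conn ends ω'' u b), decide (Conn ends ω'' a₂ c), decide (Conn ends ω'' a₂ b), decide (Conn ends ω'' c b)) = v}}} := by
    ext ω'
    simp only [Set.mem_setOf_eq]
    simp only [conn_option_of_none_false ends x y _ (h0 ω'), hsome ω']
  rw [hset, prob_option_some]
  rfl

/-- **Outside transfer** for a new edge `x–y` on top of arbitrary weights: disintegration along the new edge,
the inner outside part as before. -/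
theorem prob_off_option_gen (p₁ : E → R) (r : R) (hx : x ∉ P) (hy : y ∉ P)
    (off : Config E → Config E)
    (hoff : (∀ ω e, e ∈ touches ends P → off ω e = false) ∧ (∀ ω e, e ∉ touches ends P → off ω e = ω e))
    (off' : Config (Option E) → Config (Option E))
    (hoff' : (∀ ω e, e ∈ touches (fun o : Option E => o.elim s(x, y) ends) P → off' ω e = false) ∧
      (∀ ω e, e ∉ touches (fun o : Option E => o.elim s(x, y) ends) P → off' ω e = ω e))
    (Z : Set (Config (Option E))) :
    prob (fun o : Option E => o.elim r p₁) {ω' : Config (Option E) | off' ω' ∈ Z} =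
      r * prob p₁ {ω : Config E | (fun o : Option E => o.elim true (off ω)) ∈ Z} +
      (1 - r) * prob p₁ {ω : Config E | (fun o : Option E => o.elim false (off ω)) ∈ Z} := by
  classical
  have hoffeq : ∀ (b : Bool) (ω : Config E), off' ((Equiv.piOptionEquivProd (β := fun _ : Option E => Bool)).symm (b, ω)) = (fun o : Option E => o.elim b (off ω)) := by
    intro b ω
    funext o
    cases o with
    | none =>
      rw [hoff'.2 _ none (by rw [touches_option_xy hx hy]; rintro ⟨e, he, _⟩; cases he)]
      rfl
    | some e =>
      by_cases he : e ∈ touches ends P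
      · rw [hoff'.1 _ (some e) ((touches_option_xy hx hy (some e)).2 ⟨e, rfl, he⟩)]
        simp only [Option.elim, hoff.1 ω e he]
      · rw [hoff'.2 _ (some e) (fun h => he (by obtain ⟨e', he', h'⟩ := (touches_option_xy hx hy (some e)).1 h; cases he'; exact h'))]
        simp only [Option.elim, hoff.2 ω e he]
        rfl
  rw [prob_option_fiber]
  simp only [Option.elim, edgeFactor_true, edgeFactor_false, Set.mem_setOf_eq, hoffeq]

end TransferGen

section TwoEdge

variable [Fintype E] [Fintype V] [DecidableEq V] {ends : E → Sym2 V} {u a₂ c : V}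

omit [Fintype E] in
/-- The two-edge configuration: `none` (edge `u–c`) open iff `b`, `some none` (edge `u–a₂`) open iff `b'`. -/
lemma two_edge_eq_single (b : Bool) :
    (fun o : Option (Option E) => o.elim b (fun o' : Option E => o'.elim false (fun _ => false))) =
      (fun o : Option (Option E) => o.elim b (fun _ => false)) := by
  funext o
  cases o with
  | none => rfl
  | some o' => cases o' <;> rfl

omit [Fintype E] [Fintype V] [DecidableEq V] in
/-- With the outer edge closed, connections in the two-edge configuration are those of the inner single edge. -/
lemma conn_two_edge_outer_closed (b' : Bool) (z w : V) :
    Conn (fun o : Option (Option E) => o.elim s(u, c) (fun o' : Option E => o'.elim s(u, a₂) ends))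
      (fun o : Option (Option E) => o.elim false (fun o' : Option E => o'.elim b' (fun _ => false))) z w ↔
    z = w ∨ (b' = true ∧ s(z, w) = s(u, a₂)) := by
  rw [conn_option_of_none_false (fun o' : Option E => o'.elim s(u, a₂) ends) u c _ rfl]
  exact conn_single_edge ends u a₂ b' z w

/-- The pattern of the two-edge configuration on the three (pairwise distinct) terminals: `(b', b, b ∧ b')`. -/
lemma two_edge_pattern (hua : u ≠ a₂) (hac : a₂ ≠ c) (huc : u ≠ c) (b b' : Bool) :
    (decide (Conn (fun o : Option (Option E) => o.elim s(u, c) (fun o' : Option E => o'.elim s(u, a₂) ends)) (fun o : Option (Option E) => o.elim b (fun o' : Option E => o'.elim b' (fun _ => false))) u a₂),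
     decide (Conn (fun o : Option (Option E) => o.elim s(u, c) (fun o' : Option E => o'.elim s(u, a₂) ends)) (fun o : Option (Option E) => o.elim b (fun o' : Option E => o'.elim b' (fun _ => false))) u c),
     decide (Conn (fun o : Option (Option E) => o.elim s(u, c) (fun o' : Option E => o'.elim s(u, a₂) ends)) (fun o : Option (Option E) => o.elim b (fun o' : Option E => o'.elim b' (fun _ => false))) a₂ c)) = (b', b, b && b') := by
  cases b with
  | false =>
    simp only [conn_two_edge_outer_closed, Sym2.eq_iff, Bool.false_and]
    cases b' <;> simp [hua, hac, huc, hua.symm, hac.symm, huc.symm]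
  | true =>
    cases b' with
    | false =>
      rw [two_edge_eq_single]
      simp only [conn_single_edge, Sym2.eq_iff, Bool.true_and]
      simp [hua, hac, huc, hua.symm, huc.symm]
    | true =>
      have h1 : Conn (fun o : Option (Option E) => o.elim s(u, c) (fun o' : Option E => o'.elim s(u, a₂) ends)) (fun o : Option (Option E) => o.elim true (fun o' : Option E => o'.elim true (fun _ => false))) u c :=
        conn_of_openAdj ⟨none, rfl, rfl⟩
      have h2 : Conn (fun o : Option (Option E) => o.elim s(u, c) (fun o' : Option E => o'.elim s(u, a₂) ends)) (fun o : Option (Option E) => o.elim true (fun o' : Option E => o'.elim true (fun _ => false))) u a₂ :=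
        conn_of_openAdj ⟨some none, rfl, rfl⟩
      have h3 := conn_trans (conn_symm h2) h1
      simp [h1, h2, h3]

end TwoEdge

section TwoEdgeProb

variable [Fintype E] [DecidableEq E] [Fintype V] [DecidableEq V] {R : Type*} [Field R] [LinearOrder R] [IsStrictOrderedRing R]
variable {ends : E → Sym2 V} {P : Set V} {u a₂ c : V}

omit [LinearOrder R] [IsStrictOrderedRing R] in
/-- The outside of the two-edge instance (`c – u – a₂`, weights `r`, `q`, the old outside zeroed) as a function of the
two new edges: disintegration along the outer edge, then the inner single-edge configuration. -/
theorem prob_off_two_edge (p : E → R) (q r : R) (hu : u ∉ P) (ha : a₂ ∉ P) (hc : c ∉ P)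
    (off₁ : Config (Option E) → Config (Option E))
    (hoff₁ : (∀ ω e, e ∈ touches (fun o : Option E => o.elim s(u, a₂) ends) P → off₁ ω e = false) ∧
      (∀ ω e, e ∉ touches (fun o : Option E => o.elim s(u, a₂) ends) P → off₁ ω e = ω e))
    (off₂ : Config (Option (Option E)) → Config (Option (Option E)))
    (hoff₂ : (∀ ω e, e ∈ touches (fun o : Option (Option E) => o.elim s(u, c) (fun o' : Option E => o'.elim s(u, a₂) ends)) P → off₂ ω e = false) ∧
      (∀ ω e, e ∉ touches (fun o : Option (Option E) => o.elim s(u, c) (fun o' : Option E => o'.elim s(u, a₂) ends)) P → off₂ ω e = ω e))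
    (Z : Set (Config (Option (Option E)))) :
    prob (fun o : Option (Option E) => o.elim r (fun o' : Option E => o'.elim q (PocketConn.zeroOn (by classical exact (touches ends P)ᶜ.toFinset) p))) {ω : Config (Option (Option E)) | off₂ ω ∈ Z} =
      r * prob (fun o : Option E => o.elim q p) {ω : Config (Option E) | (fun o : Option (Option E) => o.elim true (fun o' : Option E => o'.elim (ω none) (fun _ => false))) ∈ Z} +
      (1 - r) * prob (fun o : Option E => o.elim q p) {ω : Config (Option E) | (fun o : Option (Option E) => o.elim false (fun o' : Option E => o'.elim (ω none) (fun _ => false))) ∈ Z} := by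
  classical
  rw [prob_off_option_gen (ends := fun o' : Option E => o'.elim s(u, a₂) ends) (x := u) (y := c) _ r hu hc off₁ hoff₁ off₂ hoff₂]
  show r * prob _ {ω : Config (Option E) | off₁ ω ∈ {ω' : Config (Option E) | (fun o : Option (Option E) => o.elim true ω') ∈ Z}} + (1 - r) * prob _ {ω : Config (Option E) | off₁ ω ∈ {ω' : Config (Option E) | (fun o : Option (Option E) => o.elim false ω') ∈ Z}} = _
  rw [prob_off_option_xy p q hu ha off₁ hoff₁, prob_off_option_xy p q hu ha off₁ hoff₁]
  rfl

omit [LinearOrder R] [IsStrictOrderedRing R] in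
/-- The outside atoms of the two-edge instance: with the pattern `(b', b, b ∧ b')` of `two_edge_pattern`. -/
theorem prob_off_two_edge_atom (p : E → R) (q r : R) (hu : u ∉ P) (ha : a₂ ∉ P) (hc : c ∉ P)
    (hua : u ≠ a₂) (hac : a₂ ≠ c) (huc : u ≠ c)
    (off₁ : Config (Option E) → Config (Option E))
    (hoff₁ : (∀ ω e, e ∈ touches (fun o : Option E => o.elim s(u, a₂) ends) P → off₁ ω e = false) ∧
      (∀ ω e, e ∉ touches (fun o : Option E => o.elim s(u, a₂) ends) P → off₁ ω e = ω e))
    (off₂ : Config (Option (Option E)) → Config (Option (Option E)))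
    (hoff₂ : (∀ ω e, e ∈ touches (fun o : Option (Option E) => o.elim s(u, c) (fun o' : Option E => o'.elim s(u, a₂) ends)) P → off₂ ω e = false) ∧
      (∀ ω e, e ∉ touches (fun o : Option (Option E) => o.elim s(u, c) (fun o' : Option E => o'.elim s(u, a₂) ends)) P → off₂ ω e = ω e))
    (v : Bool × Bool × Bool) :
    prob (fun o : Option (Option E) => o.elim r (fun o' : Option E => o'.elim q (PocketConn.zeroOn (by classical exact (touches ends P)ᶜ.toFinset) p))) {ω : Config (Option (Option E)) | off₂ ω ∈ {ω'' : Config (Option (Option E)) | (decide (Conn (fun o : Option (Option E) => o.elim s(u, c) (fun o' : Option E => o'.elim s(u, a₂) ends)) ω'' u a₂), decide (Conn (fun o : Option (Option E) => o.elim s(u, c) (fun o' : Option E => o'.elim s(u, a₂) ends)) ω'' u c), decide (Conn (fun o : Option (Option E) => o.elim s(u, c) (fun o' : Option E => o'.elim s(u, a₂) ends)) ω'' a₂ c)) = v}} =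
      r * (if v.2.1 = true ∧ v.2.2 = v.1 then edgeFactor q v.1 else 0) +
      (1 - r) * (if v.2.1 = false ∧ v.2.2 = false then edgeFactor q v.1 else 0) := by
  classical
  rw [prob_off_two_edge p q r hu ha hc off₁ hoff₁ off₂ hoff₂]
  obtain ⟨v1, v2, v3⟩ := v
  have e1 : {ω : Config (Option E) | (fun o : Option (Option E) => o.elim true (fun o' : Option E => o'.elim (ω none) (fun _ => false))) ∈ {ω'' : Config (Option (Option E)) | (decide (Conn (fun o : Option (Option E) => o.elim s(u, c) (fun o' : Option E => o'.elim s(u, a₂) ends)) ω'' u a₂), decide (Conn (fun o : Option (Option E) => o.elim s(u, c) (fun o' : Option E => o'.elim s(u, a₂) ends)) ω'' u c), decide (Conn (fun o : Option (Option E) => o.elim s(u, c) (fun o' : Option E => o'.elim s(u, a₂) ends)) ω'' a₂ c)) = (v1, v2, v3)}} =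
      {ω : Config (Option E) | (ω none, true, ω none) = (v1, v2, v3)} := by
    ext ω
    simp only [Set.mem_setOf_eq, two_edge_pattern hua hac huc, Bool.true_and]
  have e2 : {ω : Config (Option E) | (fun o : Option (Option E) => o.elim false (fun o' : Option E => o'.elim (ω none) (fun _ => false))) ∈ {ω'' : Config (Option (Option E)) | (decide (Conn (fun o : Option (Option E) => o.elim s(u, c) (fun o' : Option E => o'.elim s(u, a₂) ends)) ω'' u a₂), decide (Conn (fun o : Option (Option E) => o.elim s(u, c) (fun o' : Option E => o'.elim s(u, a₂) ends)) ω'' u c), decide (Conn (fun o : Option (Option E) => o.elim s(u, c) (fun o' : Option E => o'.elim s(u, a₂) ends)) ω'' a₂ c)) = (v1, v2, v3)}} =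
      {ω : Config (Option E) | (ω none, false, false) = (v1, v2, v3)} := by
    ext ω
    simp only [Set.mem_setOf_eq, two_edge_pattern hua hac huc, Bool.false_and]
  rw [e1, e2]
  have hsel : ∀ (b b' : Bool), prob (fun o : Option E => o.elim q p) {ω : Config (Option E) | (ω none, b, b') = (v1, v2, v3)} =
      if b = v2 ∧ b' = v3 then edgeFactor q v1 else 0 := by
    intro b b'
    by_cases h : b = v2 ∧ b' = v3
    · obtain ⟨rfl, rfl⟩ := h
      have : {ω : Config (Option E) | (ω none, b, b') = (v1, b, b')} = {ω : Config (Option E) | ω none = v1} := by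
        ext ω
        simp only [Set.mem_setOf_eq, Prod.mk.injEq, and_true]
      rw [this, prob_option_none]
      simp only [Option.elim, and_self, if_true]
    · have : {ω : Config (Option E) | (ω none, b, b') = (v1, v2, v3)} = ∅ := by
        ext ω
        simp only [Set.mem_setOf_eq, Prod.mk.injEq, Set.mem_empty_iff_false, iff_false]
        rintro ⟨_, h2, h3⟩
        exact h ⟨h2, h3⟩
      rw [this, prob_empty]
      simp only [h, if_false]
  have hsel1 : prob (fun o : Option E => o.elim q p) {ω : Config (Option E) | (ω none, true, ω none) = (v1, v2, v3)} =
      if v2 = true ∧ v3 = v1 then edgeFactor q v1 else 0 := by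
    by_cases h : v2 = true ∧ v3 = v1
    · obtain ⟨h2, h3⟩ := h
      rw [h2, h3]
      have : {ω : Config (Option E) | (ω none, true, ω none) = (v1, true, v1)} = {ω : Config (Option E) | ω none = v1} := by
        ext ω
        simp only [Set.mem_setOf_eq, Prod.mk.injEq, true_and, and_self]
      rw [this, prob_option_none]
      simp only [Option.elim, and_self, if_true]
    · have : {ω : Config (Option E) | (ω none, true, ω none) = (v1, v2, v3)} = ∅ := by
        ext ω
        simp only [Set.mem_setOf_eq, Prod.mk.injEq, Set.mem_empty_iff_false, iff_false]
        rintro ⟨h1, h2, h3⟩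
        exact h ⟨h2.symm, h3.symm.trans h1⟩
      rw [this, prob_empty]
      simp only [h, if_false]
  rw [hsel1, hsel false false]
  have hc1 : (false = v2 ∧ false = v3) ↔ (v2 = false ∧ v3 = false) := by
    constructor
    · rintro ⟨h1, h2⟩; exact ⟨h1.symm, h2.symm⟩
    · rintro ⟨h1, h2⟩; exact ⟨h1.symm, h2.symm⟩
  simp only [hc1]

omit [LinearOrder R] [IsStrictOrderedRing R] in
/-- `D₀` of the two-edge instance: both new edges closed, `(1 − r)(1 − q)`. -/
theorem prob_off_two_edge_PD (p : E → R) (q r : R) (hu : u ∉ P) (ha : a₂ ∉ P) (hc : c ∉ P)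
    (hua : u ≠ a₂) (hac : a₂ ≠ c) (huc : u ≠ c)
    (off₁ : Config (Option E) → Config (Option E))
    (hoff₁ : (∀ ω e, e ∈ touches (fun o : Option E => o.elim s(u, a₂) ends) P → off₁ ω e = false) ∧
      (∀ ω e, e ∉ touches (fun o : Option E => o.elim s(u, a₂) ends) P → off₁ ω e = ω e))
    (off₂ : Config (Option (Option E)) → Config (Option (Option E)))
    (hoff₂ : (∀ ω e, e ∈ touches (fun o : Option (Option E) => o.elim s(u, c) (fun o' : Option E => o'.elim s(u, a₂) ends)) P → off₂ ω e = false) ∧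
      (∀ ω e, e ∉ touches (fun o : Option (Option E) => o.elim s(u, c) (fun o' : Option E => o'.elim s(u, a₂) ends)) P → off₂ ω e = ω e)) :
    prob (fun o : Option (Option E) => o.elim r (fun o' : Option E => o'.elim q (PocketConn.zeroOn (by classical exact (touches ends P)ᶜ.toFinset) p))) {ω : Config (Option (Option E)) | off₂ ω ∈ PDEvent (fun o : Option (Option E) => o.elim s(u, c) (fun o' : Option E => o'.elim s(u, a₂) ends)) u a₂ c} = (1 - r) * (1 - q) := by
  classical
  rw [prob_off_two_edge p q r hu ha hc off₁ hoff₁ off₂ hoff₂]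
  have e1 : {ω : Config (Option E) | (fun o : Option (Option E) => o.elim true (fun o' : Option E => o'.elim (ω none) (fun _ => false))) ∈ PDEvent (fun o : Option (Option E) => o.elim s(u, c) (fun o' : Option E => o'.elim s(u, a₂) ends)) u a₂ c} = ∅ := by
    ext ω
    simp only [Set.mem_setOf_eq, PDEvent, Dtilde, UnionCluster.inU, Set.mem_inter_iff, Set.mem_compl_iff, Set.mem_union, mem_connEvent, Set.mem_empty_iff_false, iff_false, not_and, not_or, not_not]
    intro _ h
    have huc' : Conn (fun o : Option (Option E) => o.elim s(u, c) (fun o' : Option E => o'.elim s(u, a₂) ends)) (fun o : Option (Option E) => o.elim true (fun o' : Option E => o'.elim (ω none) (fun _ => false))) u c :=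
      conn_of_openAdj ⟨none, rfl, rfl⟩
    exact absurd (conn_symm huc') h
  have e2 : {ω : Config (Option E) | (fun o : Option (Option E) => o.elim false (fun o' : Option E => o'.elim (ω none) (fun _ => false))) ∈ PDEvent (fun o : Option (Option E) => o.elim s(u, c) (fun o' : Option E => o'.elim s(u, a₂) ends)) u a₂ c} = {ω : Config (Option E) | ω none = false} := by
    ext ω
    simp only [Set.mem_setOf_eq, PDEvent, Dtilde, UnionCluster.inU, Set.mem_inter_iff, Set.mem_compl_iff, Set.mem_union, mem_connEvent, conn_two_edge_outer_closed, Sym2.eq_iff]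
    cases hb : ω none <;> simp [hua, hua.symm, hac.symm, huc.symm]
  rw [e1, e2, prob_empty, prob_option_none]
  simp only [Option.elim, edgeFactor_false, mul_zero, zero_add]

omit [LinearOrder R] [IsStrictOrderedRing R] in
/-- `t₀` of the two-edge instance: `a₂ ~ c` with `a₂ ≁ u` is impossible, `0`. -/
theorem prob_off_two_edge_T (p : E → R) (q r : R) (hu : u ∉ P) (ha : a₂ ∉ P) (hc : c ∉ P)
    (hua : u ≠ a₂) (hac : a₂ ≠ c) (huc : u ≠ c)
    (off₁ : Config (Option E) → Config (Option E))
    (hoff₁ : (∀ ω e, e ∈ touches (fun o : Option E => o.elim s(u, a₂) ends) P → off₁ ω e = false) ∧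
      (∀ ω e, e ∉ touches (fun o : Option E => o.elim s(u, a₂) ends) P → off₁ ω e = ω e))
    (off₂ : Config (Option (Option E)) → Config (Option (Option E)))
    (hoff₂ : (∀ ω e, e ∈ touches (fun o : Option (Option E) => o.elim s(u, c) (fun o' : Option E => o'.elim s(u, a₂) ends)) P → off₂ ω e = false) ∧
      (∀ ω e, e ∉ touches (fun o : Option (Option E) => o.elim s(u, c) (fun o' : Option E => o'.elim s(u, a₂) ends)) P → off₂ ω e = ω e)) :
    prob (fun o : Option (Option E) => o.elim r (fun o' : Option E => o'.elim q (PocketConn.zeroOn (by classical exact (touches ends P)ᶜ.toFinset) p))) {ω : Config (Option (Option E)) | off₂ ω ∈ TEvent (fun o : Option (Option E) => o.elim s(u, c) (fun o' : Option E => o'.elim s(u, a₂) ends)) u a₂ c} = 0 := by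
  classical
  rw [prob_off_two_edge p q r hu ha hc off₁ hoff₁ off₂ hoff₂]
  have e1 : {ω : Config (Option E) | (fun o : Option (Option E) => o.elim true (fun o' : Option E => o'.elim (ω none) (fun _ => false))) ∈ TEvent (fun o : Option (Option E) => o.elim s(u, c) (fun o' : Option E => o'.elim s(u, a₂) ends)) u a₂ c} = ∅ := by
    ext ω
    simp only [Set.mem_setOf_eq, TEvent, Set.mem_inter_iff, Set.mem_compl_iff, mem_connEvent, Set.mem_empty_iff_false, iff_false, not_and]
    intro h1 h2
    cases hb : ω none with
    | true =>
      rw [hb] at h1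
      have hua' : Conn (fun o : Option (Option E) => o.elim s(u, c) (fun o' : Option E => o'.elim s(u, a₂) ends)) (fun o : Option (Option E) => o.elim true (fun o' : Option E => o'.elim true (fun _ => false))) u a₂ :=
        conn_of_openAdj ⟨some none, rfl, rfl⟩
      exact h1 (conn_symm hua')
    | false =>
      rw [hb, two_edge_eq_single, conn_single_edge, Sym2.eq_iff] at h2
      rcases h2 with h | ⟨_, ⟨h, _⟩ | ⟨_, h⟩⟩
      · exact hac h
      · exact hua h.symm
      · exact huc h.symm
  have e2 : {ω : Config (Option E) | (fun o : Option (Option E) => o.elim false (fun o' : Option E => o'.elim (ω none) (fun _ => false))) ∈ TEvent (fun o : Option (Option E) => o.elim s(u, c) (fun o' : Option E => o'.elim s(u, a₂) ends)) u a₂ c} = ∅ := by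
    ext ω
    simp only [Set.mem_setOf_eq, TEvent, Set.mem_inter_iff, Set.mem_compl_iff, mem_connEvent, conn_two_edge_outer_closed, Sym2.eq_iff, Set.mem_empty_iff_false, iff_false, not_and]
    cases hb : ω none <;> simp [hua, hac, hua.symm, hac.symm, huc.symm]
  rw [e1, e2, prob_empty]
  ring

end TwoEdgeProb


end PocketAddEdge

end RootLeafU

end Summit.Ventures.PercRepro2
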